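import Summits.HubbardSuperconductivity.HubbardSuperconductivity.Theses.CooperSharpness
import Summits.HubbardSuperconductivity.HubbardSuperconductivity.Theorems.TwTipContinuation.Negative.TipNormalForm

/-!
# Route `CooperSharpness` — support item `FloorGivesLRO` (stmt-HubbardSuperconductivity-12853)

LIMINF BOOKKEEPING. A uniform floor `m > 0` on the d-wave order density
`θ_L(ψ) = L⁻⁴ re ⟨ψ, pFᴴ pF ψ⟩` of every normalised `(N_L, S^z = 0)`-sector ground state of
`hubbardTorus 2 L 1 U` at every even `L ≥ L₀` implies the summit matrix at `(U, δ)`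
(`HasLongRangeOrder` of the torus pull-back of the pair-field correlations along every admissible
ground-state sequence). After clearing the denominator `L⁴ > 0` this is exactly the tree's
even-side `liminf` bookkeeping `summitMatrix_of_everyGSOrder`
(`Theorems/TwTipContinuation/Negative/TipNormalForm.lean`: `lroTerm_eq`, the a-priori bound
`expect_pairIntensity_le` keeping Mathlib's real `liminf` off its junk value, `le_liminf_of_le`).

Sources: D. J. Scalapino, Phys. Rep. 250 (1995) 329, §2; R. B. Griffiths, Phys. Rev. 152 (1966)
240; H. Tasaki, Physics and Mathematics of Quantum Many-Body Systems (2020), §2. No new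
definitions.
-/

-- the mandated namespace `Summit.<Summit>.<Problem>.Theorems` repeats `HubbardSuperconductivity`
-- (single-problem summit, D-0017), which the `dupNamespace` linter flags on every declaration
set_option linter.dupNamespace false

namespace Summit.HubbardSuperconductivity.HubbardSuperconductivity.Theorems.CooperSharpness

open Matrix Literature.MathematicalPhysics.QuantumLattice Literature.Probability.LatticeModels
open Summit.HubbardSuperconductivity.TwTipContinuation.Negative (summitMatrix_of_everyGSOrder)

/-- **`FloorGivesLRO`** (stmt-HubbardSuperconductivity-12853): a uniform every-ground-state floor
`m > 0` on `L⁻⁴ re ⟨ψ, pFᴴ pF ψ⟩` at all even sides `L ≥ L₀` gives d-wave long-range order of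
every admissible ground-state sequence at `(U, δ)` — the summit's matrix. Proof: multiply the
floor through by `L⁴` and apply `summitMatrix_of_everyGSOrder`.
[cite: Scalapino1995, §2; Griffiths1966] -/
theorem floorGivesLRO_proof :
    Summit.HubbardSuperconductivity.HubbardSuperconductivity.Theses.CooperSharpness.FloorGivesLRO := by
  intro U δ m L₀ hm hfloor N ψ hadm
  refine summitMatrix_of_everyGSOrder ⟨m, hm, L₀, ?_⟩ N ψ hadm
  intro L _ hL hE φ hφ1 hφ
  have hL0 : (0 : ℝ) < (L : ℝ) := Nat.cast_pos.2 (Nat.pos_of_ne_zero (NeZero.ne L))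
  have hL4 : (0 : ℝ) < (L : ℝ) ^ 4 := by positivity
  have h := hfloor L hL hE φ hφ1 hφ
  rwa [le_div_iff₀ hL4] at h

end Summit.HubbardSuperconductivity.HubbardSuperconductivity.Theorems.CooperSharpness
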